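import Summits.CriticalPhenomena.PercolationContinuityZ3.Theorems.PercNearOneGluingNoHeavyLowerTailMixCSHHubTransfer
import Summits.CriticalPhenomena.PercolationContinuityZ3.Theorems.PercNearOneGluingNoHeavyLowerTailMixCSHDefs
import HarnessLib

/-!
# The MIXED conditioned slack hierarchy (hub observer) — LEMMA H: the H-part of the world-wise unfolding is nonnegative,
# given the mixed two-source diagonal (Htw-mix)

Support file (`--supports stmt-CriticalPhenomena-4575`), prover `prim-ineq-gen-7` (gen 8).  No definitions, no named facts, no sorries.
Memo `prim-ineq-gen-7/PROOF-Q9-MIXED-CSH.md` §3.4; roadmap §9.3 (brick "Hpart-mix"; mirror of `CSH.hpart_nonneg_of_htw`, prim-png-lead).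

Setting: weights `< 1`, owner `x ∈ S` (`S` = owner ∪ decoys), hub set `Σ`, second observer `v ∉ S ∪ Y`, worlds `w^ω` = `w` zeroed on the pairs meeting
the open vertex cluster of the avoided set `Y`, integrated over `ω ∈ {x ↮ Y}`; `g` monotone `≥ 0`.  The hub row of a world carries the factor
`1{Σ ↮_ω Y}` (worlds whose boundary meets `Σ` have no hub row, like worlds containing a vertex observer), and its test is `{Σ ↔ S}`;
the global constant is `p = mixObsConst w Σ v (S ∪ Y) = μ(Σ∩C_v ≠ ∅, Σ ↮ S∪Y | v ↮ S∪Y)`.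
CLAIM (`MixCSH.hpart_nonneg_of_htw_hub`): `0 ≤ ∫_{x↮Y} [1{Σ↮_ωY}·Cov_{w^ω}(g(C_x), 1{Σ↔S}) − p·Cov_{w^ω}(g(C_x), 1{v↔S})] dμ_w`, GIVEN the mixed
two-source diagonal (Htw-mix, hypothesis `hHtw`, memo §3.4 — a META-A2 instance, to be landed):
`μ(v↮S∪Y, hub)·∫ Cov_{w^ω}(g,1{v↔S}) ≤ μ(v↮S∪Y)·∫ p^Σ_ω·Cov_{w^ω}(g,1{v↔S})`, `p^Σ_ω = 1{Σ↮_ωY}·μ_{w^ω}(Σ∩C_v≠∅, Σ↮S | v↮S)`.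
Proof: (K6) with a hub observer in each world (`MixCSH.covTransfer_relaySet_hub` at the weights `w^ω`), then (Htw-mix) trades `p^Σ_ω` for `p`.
[cite: VandenbergHaggstromKahn2005, Thm. 2.1 (p. 9) at q = 1, Thm. 1.4 (p. 7)] [cite: KozmaNitzan2024, Question 9 (§5.5 p. 36)]
-/

noncomputable section

namespace Summit.CriticalPhenomena.PercolationContinuityZ3.Theorems

open MeasureTheory Set
open Literature.Probability.LatticeModels (prodBernoulli)
open Literature.Probability.Percolation
open scoped Classical

namespace MixCSH

variable {V : Type*} [Fintype V]

/-- **LEMMA H with a hub observer** (memo §3.4): the H-part of the mixed world-wise unfolding is nonnegative, given (Htw-mix).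
[cite: VandenbergHaggstromKahn2005, Thm. 2.1 (p. 9), Thm. 1.4 (p. 7)] [cite: KozmaNitzan2024, Question 9 (§5.5 p. 36)] -/
theorem hpart_nonneg_of_htw_hub (w : Sym2 V → unitInterval) (hw : ∀ e, w e < 1) (x : V) (Y : Set V) (S : Finset V)
    (hxS : x ∈ S) (Sig : Set V) (v : V) (hvS : v ∉ S) (hvY : v ∉ Y) (g : Set (Sym2 V) → ℝ) (hg : Monotone g) (hg0 : ∀ C, 0 ≤ g C)
    (hHtw : (prodBernoulli w).real ({ω : BondConfig V | ∀ a ∈ (↑S ∪ Y : Set V), ¬ (openGraph ω).Reachable v a} ∩ hubEv Sig v (↑S ∪ Y)) *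
        (∫ ω in {ω : BondConfig V | ∀ y ∈ Y, ¬ (openGraph ω).Reachable x y},
          ((∫ η in (⋃ t ∈ S, openConn v t), g (openEdgeCluster η x)
              ∂(prodBernoulli fun e => if (∃ z ∈ e, ∃ y ∈ Y, (openGraph ω).Reachable y z) then (0 : unitInterval) else w e)) -
            (prodBernoulli fun e => if (∃ z ∈ e, ∃ y ∈ Y, (openGraph ω).Reachable y z) then (0 : unitInterval) else w e).real
                (⋃ t ∈ S, openConn v t) *
              (∫ η, g (openEdgeCluster η x)
                ∂(prodBernoulli fun e => if (∃ z ∈ e, ∃ y ∈ Y, (openGraph ω).Reachable y z) then (0 : unitInterval) else w e)))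
          ∂(prodBernoulli w)) ≤
      (prodBernoulli w).real {ω : BondConfig V | ∀ a ∈ (↑S ∪ Y : Set V), ¬ (openGraph ω).Reachable v a} *
        (∫ ω in {ω : BondConfig V | ∀ y ∈ Y, ¬ (openGraph ω).Reachable x y},
          ((if (∀ σ ∈ Sig, ∀ y ∈ Y, ¬ (openGraph ω).Reachable y σ) then (1 : ℝ) else 0) *
            ((prodBernoulli fun e => if (∃ z ∈ e, ∃ y ∈ Y, (openGraph ω).Reachable y z) then (0 : unitInterval) else w e).real
                ({η : BondConfig V | ∀ t ∈ S, ¬ (openGraph η).Reachable v t} ∩ hubEv Sig v ↑S) /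
              (prodBernoulli fun e => if (∃ z ∈ e, ∃ y ∈ Y, (openGraph ω).Reachable y z) then (0 : unitInterval) else w e).real
                {η : BondConfig V | ∀ t ∈ S, ¬ (openGraph η).Reachable v t})) *
          ((∫ η in (⋃ t ∈ S, openConn v t), g (openEdgeCluster η x)
              ∂(prodBernoulli fun e => if (∃ z ∈ e, ∃ y ∈ Y, (openGraph ω).Reachable y z) then (0 : unitInterval) else w e)) -
            (prodBernoulli fun e => if (∃ z ∈ e, ∃ y ∈ Y, (openGraph ω).Reachable y z) then (0 : unitInterval) else w e).real
                (⋃ t ∈ S, openConn v t) *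
              (∫ η, g (openEdgeCluster η x)
                ∂(prodBernoulli fun e => if (∃ z ∈ e, ∃ y ∈ Y, (openGraph ω).Reachable y z) then (0 : unitInterval) else w e)))
          ∂(prodBernoulli w))) :
    0 ≤ ∫ ω in {ω : BondConfig V | ∀ y ∈ Y, ¬ (openGraph ω).Reachable x y},
      ((if (∀ σ ∈ Sig, ∀ y ∈ Y, ¬ (openGraph ω).Reachable y σ) then (1 : ℝ) else 0) *
          ((∫ η in {η : BondConfig V | ∃ σ ∈ Sig, ∃ t ∈ S, (openGraph η).Reachable t σ}, g (openEdgeCluster η x)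
              ∂(prodBernoulli fun e => if (∃ z ∈ e, ∃ y ∈ Y, (openGraph ω).Reachable y z) then (0 : unitInterval) else w e)) -
            (prodBernoulli fun e => if (∃ z ∈ e, ∃ y ∈ Y, (openGraph ω).Reachable y z) then (0 : unitInterval) else w e).real
                {η : BondConfig V | ∃ σ ∈ Sig, ∃ t ∈ S, (openGraph η).Reachable t σ} *
              (∫ η, g (openEdgeCluster η x)
                ∂(prodBernoulli fun e => if (∃ z ∈ e, ∃ y ∈ Y, (openGraph ω).Reachable y z) then (0 : unitInterval) else w e))) -
        mixObsConst w Sig v (↑S ∪ Y) *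
          ((∫ η in (⋃ t ∈ S, openConn v t), g (openEdgeCluster η x)
              ∂(prodBernoulli fun e => if (∃ z ∈ e, ∃ y ∈ Y, (openGraph ω).Reachable y z) then (0 : unitInterval) else w e)) -
            (prodBernoulli fun e => if (∃ z ∈ e, ∃ y ∈ Y, (openGraph ω).Reachable y z) then (0 : unitInterval) else w e).real
                (⋃ t ∈ S, openConn v t) *
              (∫ η, g (openEdgeCluster η x)
                ∂(prodBernoulli fun e => if (∃ z ∈ e, ∃ y ∈ Y, (openGraph ω).Reachable y z) then (0 : unitInterval) else w e))))
      ∂(prodBernoulli w) := by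
  set μ := prodBernoulli w with hμ
  -- world weights and world quantities
  set wW : BondConfig V → Sym2 V → unitInterval := fun ω e =>
    if (∃ z ∈ e, ∃ y ∈ Y, (openGraph ω).Reachable y z) then (0 : unitInterval) else w e with hwW
  set χ : BondConfig V → ℝ := fun ω => if (∀ σ ∈ Sig, ∀ y ∈ Y, ¬ (openGraph ω).Reachable y σ) then (1 : ℝ) else 0 with hχ
  set CovO : BondConfig V → ℝ := fun ω =>
    (∫ η in {η : BondConfig V | ∃ σ ∈ Sig, ∃ t ∈ S, (openGraph η).Reachable t σ}, g (openEdgeCluster η x) ∂(prodBernoulli (wW ω))) -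
      (prodBernoulli (wW ω)).real {η : BondConfig V | ∃ σ ∈ Sig, ∃ t ∈ S, (openGraph η).Reachable t σ} *
        ∫ η, g (openEdgeCluster η x) ∂(prodBernoulli (wW ω)) with hCovO
  set CovV : BondConfig V → ℝ := fun ω =>
    (∫ η in (⋃ t ∈ S, openConn v t), g (openEdgeCluster η x) ∂(prodBernoulli (wW ω))) -
      (prodBernoulli (wW ω)).real (⋃ t ∈ S, openConn v t) * ∫ η, g (openEdgeCluster η x) ∂(prodBernoulli (wW ω)) with hCovV
  set pW : BondConfig V → ℝ := fun ω =>
    (prodBernoulli (wW ω)).real ({η : BondConfig V | ∀ t ∈ S, ¬ (openGraph η).Reachable v t} ∩ hubEv Sig v ↑S) /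
      (prodBernoulli (wW ω)).real {η : BondConfig V | ∀ t ∈ S, ¬ (openGraph η).Reachable v t} with hpW
  set M : ℝ := μ.real {ω : BondConfig V | ∀ a ∈ (↑S ∪ Y : Set V), ¬ (openGraph ω).Reachable v a} with hM
  set E : ℝ := μ.real ({ω : BondConfig V | ∀ a ∈ (↑S ∪ Y : Set V), ¬ (openGraph ω).Reachable v a} ∩ hubEv Sig v (↑S ∪ Y)) with hE
  set Dset : Set (BondConfig V) := {ω : BondConfig V | ∀ y ∈ Y, ¬ (openGraph ω).Reachable x y} with hDset
  change E * ∫ ω in Dset, CovV ω ∂μ ≤ M * ∫ ω in Dset, (χ ω * pW ω) * CovV ω ∂μ at hHtw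
  change 0 ≤ ∫ ω in Dset, (χ ω * CovO ω - mixObsConst w Sig v (↑S ∪ Y) * CovV ω) ∂μ
  have hmeas : ∀ T : Set (BondConfig V), MeasurableSet T := fun _ => MeasurableSet.of_discrete
  have hint : ∀ (k : BondConfig V → ℝ) (T : Set (BondConfig V)), IntegrableOn k T μ :=
    fun k T => (Integrable.of_finite).integrableOn
  -- positivity of the global conditioning probability and the observers' constant
  have hMpos : 0 < M := by
    refine CSH.prodBernoulli_real_pos_of_empty_mem w hw (fun a ha hreach => ?_)
    have hbot : openGraph (∅ : BondConfig V) = ⊥ := by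
      unfold openGraph; exact SimpleGraph.fromEdgeSet_empty
    rw [hbot, SimpleGraph.reachable_bot] at hreach
    subst hreach
    rcases ha with ha | ha
    · exact hvS (Finset.mem_coe.1 ha)
    · exact hvY ha
  have hobs : mixObsConst w Sig v (↑S ∪ Y) = E / M := by unfold mixObsConst; rfl
  -- (K6) with a hub observer in each world: `χ ω · pW ω · CovV ω ≤ χ ω · CovO ω`
  have hworld : ∀ ω : BondConfig V, (χ ω * pW ω) * CovV ω ≤ χ ω * CovO ω := by
    intro ω
    by_cases hχ0 : ∀ σ ∈ Sig, ∀ y ∈ Y, ¬ (openGraph ω).Reachable y σ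
    · have hχ1 : χ ω = 1 := by simp only [hχ, if_pos hχ0]
      rw [hχ1, one_mul, one_mul]
      have hK6 := covTransfer_relaySet_hub (wW ω) S Sig v x hxS g hg hg0
      have hlt : ∀ e, wW ω e < 1 := by
        intro e
        simp only [hwW]
        split_ifs
        · exact zero_lt_one
        · exact hw e
      have hMWpos : 0 < (prodBernoulli (wW ω)).real {η : BondConfig V | ∀ t ∈ S, ¬ (openGraph η).Reachable v t} := by
        refine CSH.prodBernoulli_real_pos_of_empty_mem (wW ω) hlt (fun t ht hreach => ?_)
        have hbot : openGraph (∅ : BondConfig V) = ⊥ := by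
          unfold openGraph; exact SimpleGraph.fromEdgeSet_empty
        rw [hbot, SimpleGraph.reachable_bot] at hreach
        exact hvS (hreach ▸ ht)
      set MW := (prodBernoulli (wW ω)).real {η : BondConfig V | ∀ t ∈ S, ¬ (openGraph η).Reachable v t} with hMW
      set EW := (prodBernoulli (wW ω)).real ({η : BondConfig V | ∀ t ∈ S, ¬ (openGraph η).Reachable v t} ∩ hubEv Sig v ↑S) with hEW
      have hEW' : EW = (prodBernoulli (wW ω)).real ({η : BondConfig V | ∀ t ∈ S, ¬ (openGraph η).Reachable v t} ∩
          ({η | ∃ σ ∈ Sig, (openGraph η).Reachable v σ} ∩ {η | ∀ σ ∈ Sig, ∀ t ∈ S, ¬ (openGraph η).Reachable t σ})) := by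
        rw [hEW]; rfl
      change (prodBernoulli (wW ω)).real ({η : BondConfig V | ∀ t ∈ S, ¬ (openGraph η).Reachable v t} ∩
          ({η | ∃ σ ∈ Sig, (openGraph η).Reachable v σ} ∩ {η | ∀ σ ∈ Sig, ∀ t ∈ S, ¬ (openGraph η).Reachable t σ})) * CovV ω ≤
          MW * CovO ω at hK6
      rw [← hEW'] at hK6
      have hp : pW ω = EW / MW := rfl
      rw [hp, div_mul_eq_mul_div, div_le_iff₀ hMWpos]
      linarith [hK6, mul_comm MW (CovO ω)]
    · have hχ0' : χ ω = 0 := by simp only [hχ, if_neg hχ0]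
      rw [hχ0']; simp
  -- integrate the world inequality over `Dset`
  have hI1 : ∫ ω in Dset, (χ ω * pW ω) * CovV ω ∂μ ≤ ∫ ω in Dset, χ ω * CovO ω ∂μ :=
    setIntegral_mono_on (hint _ _) (hint _ _) (hmeas Dset) fun ω _ => hworld ω
  -- (Htw-mix) divided by `M`
  have hI2 : E / M * ∫ ω in Dset, CovV ω ∂μ ≤ ∫ ω in Dset, (χ ω * pW ω) * CovV ω ∂μ := by
    rw [div_mul_eq_mul_div, div_le_iff₀ hMpos]
    linarith [hHtw, mul_comm M (∫ ω in Dset, (χ ω * pW ω) * CovV ω ∂μ)]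
  rw [integral_sub (hint _ _) (hint _ _), integral_const_mul, hobs]
  linarith [hI1, hI2]

end MixCSH

end Summit.CriticalPhenomena.PercolationContinuityZ3.Theorems
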